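import Mathlib
import HarnessLib.Audit
import Summits.PneNP.PneNP.Theorems.PstarMenuLocality

/-!
# Locality of exact coincidences: every monomial of the second reader touches the AND variables of `F₁` (ROUND-24, O1; memo g26 §60)

FRONTIER range-avoidance ladder, rung F-N3, ROUND 24 (cell `pnp-ideate`, prover-2 memo `g26/O1-LOCALITY-g26.md` §60; typed targets
`PstarCoreBoundTargets.TerminalFive` / `TerminalPeelable` (p646951); census node `PstarSharpGateBudgetAssembly.SharpMenuCriterionBoundGateBudget`;
restricted-model proof complexity — nothing here bears on `P` versus `NP`).

Branch (B) of the sharp census node is the EXACT COINCIDENCE (`PstarCoincidenceExact.NoCoincidenceExact`): a first reader `R₁ = Σ_{f ∈ F₁} p_f q_f`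
(no linear part) and a second reader `R₂ = (C₂, G ∪ F₂)` carrying the channel menu `G` in full, JOINTLY UNSATISFIABLE OVER ALL ASSIGNMENTS.  The
poison rule of g24 (`false_of_coincidence_junk`) needed the junk monomial to be alone on both its variables.  With the flip formula of
`PstarMenuLocality` the full locality statement follows, exactly as for branch (A):

* `coincidence_starSum_pinned` — a variable `v` in no AND slot of `F₁` has its partner sum in `G ∪ F₂` PINNED on `{R₁ = β₁}`:
  `[v ∈ C₂] + starSum (G ∪ F₂) v ≡ 0` there (flipping `x_v` keeps `R₁`; `R₂` misses `β₂` at both points);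
* **`false_of_far_monomial_coincidence`** — no monomial of `R₂` has BOTH AND variables outside the AND slots of `F₁` (given `{R₁ = β₁} ≠ ∅`);
* **`coincidence_touches`** — census form under simple overlaps: every `g ∈ G ∪ F₂` shares an AND variable with a member of `F₁`;
* `menu_touches_folds` / `fold_touches_folds` — in the data of `NoCoincidenceExact` (essentiality supplies `{R₁ = β₁} ≠ ∅`): every menu
  monomial, and every fold of `F₂ ∖ F₁`, shares an AND variable with a member of `F₁`.

Since `F₁` is tiny (polar rank `< 6`: at most two chords, no induced 3-matching), this confines the coincidence-certifying menus of a channel to the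
monomials through the handful of AND variables of `F₁` — for all core sizes.
-/

set_option linter.dupNamespace false -- `Summit.PneNP.PneNP.…`: summit = sub-problem name (D-0017 single-conjunct layout)

open Finset Literature.Computability.Complexity
open Summit.PneNP.PneNP.Theorems.PstarFibrePolys (bit bit_injective)
open Summit.PneNP.PneNP.Theorems.PstarSALevel (varSet SimpleOverlap)
open Summit.PneNP.PneNP.Theorems.PstarGapOneAll (gval)
open Summit.PneNP.PneNP.Theorems.PstarGConstraint (gval_update_of_forall_ne)
open Summit.PneNP.PneNP.Theorems.PstarMenuLocality (starSum starSum_update_partner bit_gval_flip pair_unique)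

namespace Summit.PneNP.PneNP.Theorems.PstarCoincidenceLocality

variable {n m : ℕ} {I : LocalMap 4 n m} {F₁ G₂ : Finset (Fin m)} {C₂ : Finset (Fin n)} {β₁ β₂ : Bool} {v w : Fin n} {g : Fin m}

/-- In `𝔽₂`, `bit (!a) + bit a = 1`. -/
private theorem bit_not_add (a : Bool) : bit (!a) + bit a = 1 := by
  cases a <;> decide

/-- **POISON RULE FOR COINCIDENCES, general form.**  `R₁ = Σ_{F₁} p q` and `R₂ = (C₂, G₂)` jointly unsatisfiable everywhere; `v` in no AND slot of
`F₁`.  Then on `{R₁ = β₁}` the partner sum of `v` in `G₂` is pinned: `[v ∈ C₂] + starSum G₂ v ≡ 0`. -/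
theorem coincidence_starSum_pinned (hI : I.IsPure xorAndPred) (hU : ∀ z : Fin n → Bool, ¬ (gval I ∅ F₁ z = β₁ ∧ gval I C₂ G₂ z = β₂))
    (hvF : ∀ f ∈ F₁, I.vars f 2 ≠ v ∧ I.vars f 3 ≠ v) {z : Fin n → Bool} (hz : gval I ∅ F₁ z = β₁) :
    (if v ∈ C₂ then (1 : ZMod 2) else 0) + starSum I G₂ v z = 0 := by
  set z' := Function.update z v (!z v) with hz'
  have hz'₁ : gval I ∅ F₁ z' = β₁ := by rw [hz', gval_update_of_forall_ne I z (notMem_empty v) hvF]; exact hz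
  have h₂ : gval I C₂ G₂ z ≠ β₂ := fun e => hU z ⟨hz, e⟩
  have h₂' : gval I C₂ G₂ z' ≠ β₂ := fun e => hU z' ⟨hz'₁, e⟩
  have heq : gval I C₂ G₂ z' = gval I C₂ G₂ z := by
    revert h₂ h₂'
    cases gval I C₂ G₂ z' <;> cases gval I C₂ G₂ z <;> cases β₂ <;> decide
  have hflip := bit_gval_flip I hI C₂ G₂ z v
  rw [← hz', heq] at hflip
  linear_combination -hflip

/-- **LOCALITY FOR COINCIDENCES: no monomial of `R₂` is far from `F₁`.**  If `g ∈ G₂` has AND pair `{v, w}` with both `v, w` outside the AND slots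
of `F₁`, the pair carried once in `G₂`, and `{R₁ = β₁}` is non-empty, the coincidence is impossible. -/
theorem false_of_far_monomial_coincidence (hI : I.IsPure xorAndPred)
    (hU : ∀ z : Fin n → Bool, ¬ (gval I ∅ F₁ z = β₁ ∧ gval I C₂ G₂ z = β₂)) (hg : g ∈ G₂)
    (hslots : (I.vars g 2 = v ∧ I.vars g 3 = w) ∨ (I.vars g 2 = w ∧ I.vars g 3 = v))
    (huniq : ∀ g' ∈ G₂, g' ≠ g → ¬ ((I.vars g' 2 = v ∧ I.vars g' 3 = w) ∨ (I.vars g' 2 = w ∧ I.vars g' 3 = v)))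
    (hvF : ∀ f ∈ F₁, I.vars f 2 ≠ v ∧ I.vars f 3 ≠ v) (hwF : ∀ f ∈ F₁, I.vars f 2 ≠ w ∧ I.vars f 3 ≠ w)
    (hA : ∃ z : Fin n → Bool, gval I ∅ F₁ z = β₁) : False := by
  obtain ⟨z, hz⟩ := hA
  set z' := Function.update z w (!z w) with hz'
  have hz'₁ : gval I ∅ F₁ z' = β₁ := by rw [hz', gval_update_of_forall_ne I z (notMem_empty w) hwF]; exact hz
  have h0 := coincidence_starSum_pinned hI hU hvF hz
  have h1 := coincidence_starSum_pinned hI hU hvF hz'₁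
  rw [hz', starSum_update_partner I hI hg hslots huniq z (!z w), bit_not_add] at h1
  have h2 : (1 : ZMod 2) = 0 := by linear_combination h1 - h0
  exact absurd h2 (by decide)

/-- **Census form (simple overlaps).**  In an exact coincidence with `{R₁ = β₁} ≠ ∅`, every monomial of `R₂` shares an AND variable with a member
of `F₁`. -/
theorem coincidence_touches (hI : I.IsPure xorAndPred) (hS : SimpleOverlap I)
    (hU : ∀ z : Fin n → Bool, ¬ (gval I ∅ F₁ z = β₁ ∧ gval I C₂ G₂ z = β₂)) (hA : ∃ z : Fin n → Bool, gval I ∅ F₁ z = β₁) (hg : g ∈ G₂) :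
    ∃ f ∈ F₁, I.vars f 2 = I.vars g 2 ∨ I.vars f 3 = I.vars g 2 ∨ I.vars f 2 = I.vars g 3 ∨ I.vars f 3 = I.vars g 3 := by
  by_contra h
  push Not at h
  exact false_of_far_monomial_coincidence hI hU hg (Or.inl ⟨rfl, rfl⟩) (pair_unique hI hS g)
    (fun f hf => ⟨(h f hf).1, (h f hf).2.1⟩) (fun f hf => ⟨(h f hf).2.2.1, (h f hf).2.2.2⟩) hA

/-! ## The node form -/

variable {J₀ : Finset (Fin m)} {c : Fin m}

/-- **Menu monomials of an exact coincidence touch `F₁`** (the form the census uses): for the data of `NoCoincidenceExact I J₀ c G` with `G`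
disjoint from `J₀`, every `g ∈ G` shares an AND variable with some member of `F₁`. -/
theorem menu_touches_folds (hI : I.IsPure xorAndPred) (hS : SimpleOverlap I) {G K F₂ : Finset (Fin m)} (hdisj : Disjoint J₀ G)
    (hK : K ⊆ J₀.erase c) (hF₁ : F₁ ⊆ K)
    (hU : ∀ z : Fin n → Bool, ¬ (gval I ∅ F₁ z = β₁ ∧ gval I C₂ (G ∪ F₂) z = β₂))
    (hflip : ∀ g ∈ K ∪ G, ∃ z : Fin n → Bool, (gval I ∅ F₁ z = β₁ ↔ g ∉ F₁) ∧ (gval I C₂ (G ∪ F₂) z = β₂ ↔ g ∉ G ∪ F₂))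
    (hg : g ∈ G) : ∃ f ∈ F₁, I.vars f 2 = I.vars g 2 ∨ I.vars f 3 = I.vars g 2 ∨ I.vars f 2 = I.vars g 3 ∨ I.vars f 3 = I.vars g 3 := by
  have hgJ : g ∉ J₀ := fun h => disjoint_left.1 hdisj h hg
  have hgF₁ : g ∉ F₁ := fun h => hgJ (mem_of_mem_erase (hK (hF₁ h)))
  obtain ⟨z, hz₁, -⟩ := hflip g (mem_union_right _ hg)
  exact coincidence_touches hI hS hU ⟨z, hz₁.2 hgF₁⟩ (mem_union_left _ hg)

/-- **Folds of the second reader not folded into the first touch `F₁` as well.** -/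
theorem fold_touches_folds (hI : I.IsPure xorAndPred) (hS : SimpleOverlap I) {G K F₂ : Finset (Fin m)} (hF₂ : F₂ ⊆ K)
    (hU : ∀ z : Fin n → Bool, ¬ (gval I ∅ F₁ z = β₁ ∧ gval I C₂ (G ∪ F₂) z = β₂))
    (hflip : ∀ g ∈ K ∪ G, ∃ z : Fin n → Bool, (gval I ∅ F₁ z = β₁ ↔ g ∉ F₁) ∧ (gval I C₂ (G ∪ F₂) z = β₂ ↔ g ∉ G ∪ F₂))
    (hg : g ∈ F₂) (hgF₁ : g ∉ F₁) :
    ∃ f ∈ F₁, I.vars f 2 = I.vars g 2 ∨ I.vars f 3 = I.vars g 2 ∨ I.vars f 2 = I.vars g 3 ∨ I.vars f 3 = I.vars g 3 := by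
  obtain ⟨z, hz₁, -⟩ := hflip g (mem_union_left _ (hF₂ hg))
  exact coincidence_touches hI hS hU ⟨z, hz₁.2 hgF₁⟩ (mem_union_right _ hg)

end Summit.PneNP.PneNP.Theorems.PstarCoincidenceLocality
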